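import Summits.BirchSwinnertonDyer.BirchSwinnertonDyer.Theorems.ClassRecordThreeKolyvaginShaOrderOfPointsDivisible
import Summits.BirchSwinnertonDyer.BirchSwinnertonDyer.Theorems.ClassRecordThreeKolyvaginHpointsAssemblyDivisibleFrame
import Summits.BirchSwinnertonDyer.Rank1Residual.X11b.KolyvaginShaAtPrimeOfGross1991
import Summits.BirchSwinnertonDyer.Rank1Residual.X11b.KolyvaginShaOrderOfLeafInputs
import Summits.BirchSwinnertonDyer.Rank1Residual.X11b.Three.KolyvaginLine
import Literature.NumberTheory.EllipticCurves.CasselsTateLevelInputs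
import Literature.NumberTheory.EllipticCurves.KolyvaginShaStructureDivisibility
import Literature.NumberTheory.EllipticCurves.McCallum1991.EigenclassesCebotarevLevelPow
import Literature.NumberTheory.EllipticCurves.GrossLMS1991.HeegnerEulerSystemCongruenceImageFree
import HarnessLib

/-!
# The «Tamagawa-absorbing» Kolyvagin–McCallum bound BY KERNEL: the named fact
# `McCallum1991_padicValNat_card_sha_primary_add_le_of_globalDivisibility` (McCallum 1991 Cor. 5.6 read as
# `ord_p #Ш(E/K)[p^∞] + 2t ≤ 2M₀` under global divisibility; Jetchev 2008 (1)) FROM three standard named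
# facts {Cassels–Tate level inputs, Gross 1991 Prop. 3.7 (2), Gross 1991 §6 / [GZ86 III (3.1)]}
# (cell `bsd-stepL`, seat `bsd-stepL-tam3-p1` g9, crux stmt-BirchSwinnertonDyer-19109 `EulerHalvesAtThree`;
# `--supports stmt-BirchSwinnertonDyer-19109 --as helper`)

HONEST FRAMING: THREE THEOREMS (no definition, no named fact, no `sorry`); CONDITIONAL on the displayed named
facts; nothing booked; no mark / label / count / tier moves; BSD is not proved for any curve. The Literature
fact `McCallum1991_padicValNat_card_sha_primary_add_le_of_globalDivisibility` (`KolyvaginShaStructureDivisibility.lean`,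
«size XL; no `_holds`») is the conjunct `hMcU` of crux 19109's citable stub `stub_factsAtThree` and the
Kolyvagin-side input of EVERY composition of the line (p419384 ff., p540392, p555403, p556885): with this
file it is DERIVED from `casselsTate_levelInputs` (Milne ADT I §6 + local CFT; shim3a), Gross 1991
Prop. 3.7 (2) (`GrossLMS1991.prop37_2_reductionCongruence`, the Eichler–Shimura congruence) and
`Gross1991_heegnerPoint_sub_ratTorsion_mem_E0` (GZ86 III (3.1) as Gross §6 uses it; = `hF1`, ALREADY a
conjunct of 19109's `stub_localFactsAtThree`), over x11b3-p2's Kolyvagin-descent chain (cell `b2b-bsdres`,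
McCallum §§2–5 mod `p^M`, Čebotarev and the Weil pairing PROVED there) and this seat's divisible refinement
of it (`…OrderTelescopeDivisibleProofs` p559585, `…OrderDivisibleProofs` p560420, `…OrderBoundDivisibleProofs`,
`…ShaBoundDivisibleProofs`, `Theorems/ClassRecordThreeKolyvaginShaOrder{AtPrime,OfPoints}Divisible`,
`…HpointsAssemblyDivisibleFrame`).

* `KolyvaginOrder.card_sha_primary_le_at_of_divT_frame_of_gross1991E0_of_prop37_of_localDuality` — the
  END at one odd surjective prime on a GIVEN frame: `#Ш(E/K)[p^∞] ≤ p^{2(M₀−t)}`,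
  `ord_p #Ш(E/K)[p^∞] + 2t ≤ 2M₀`, from {`hE0`, `hγ`} + the class-form divisibility `hDivT` on the frame +
  the displayed Cassels–Tate inputs; `hpoints` by `hpoints_at_of_perLevelChoice_of_divT_frame` with
  `hrec`/`hCM`/`h53` DISCHARGED by the tree theorems and `hGZ := KolyvaginHloc.hGZ_of_gross1991E0 hE0`,
  `hγ := hγ.endBinder` (x11b3 GEN 52–54 VERBATIM), `hRT` from `poitouTate_sum_localTatePairing_eq_zero_holds`
  (`KolyvaginReciprocity.kolyvaginReciprocityFinset_of_poitouTate`).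
* `McCallum1991_padicValNat_card_sha_primary_add_le_of_globalDivisibility_of_casselsTate_of_prop37_of_E0` —
  THE NAMED FACT, from the three named facts. Dictionary: `ρ̄` onto from the fact's tower at `n = 1`;
  `P ↔ P(1)` on the fact's frame (`toGeomPoints_map_algebraMap`, injectivity of `E(K[1]) → E(K̄)`);
  `IsHeegnerPoint` and clause (c) on THAT frame by Shimura reciprocity at conductor `1`
  (`heegnerPointOfConductor_one_galoisConj_holds`, as in `heegnerSystem_exists_isHeegnerPoint_map_eq_derivedPoint_one`);
  `hDivT` from the fact's global divisibility at depth `min(M, t)` (index `≥ M` from `Frob(ℓ) = Frob(∞)` on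
  `K(E[p^M])`, `McCallum1991.le_kolyvaginIndex_of_frobEqFrobInfty`) through McCallum's Cor. 4.5 in class form
  (`kolyvaginClass_eq_cls`, `cls_zsmul`, `cls_eq_zero_of_mem`); the case `M₀ = 0` by x11b3's annihilator END
  (`Ш[p^∞] = 0`) with `t = 0` forced by McCallum's Lemma 5.1 (`Koly.pDiv_one_iff_exists_zsmul_eq`); the case
  `M₀ ≥ 1` by the END with the Weil pairing at level `p^{2M₀}` (`exists_weilPairing_holds`) and the
  Cassels–Tate inputs from `casselsTate_levelInputs`.
* `McCallum1991_padicValNat_card_sha_primary_add_le_of_globalDivisibility_of_casselsTate_of_frobeniusCongruence_of_E0`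
  — the same, keyed to the IMAGE-FREE congruence `GrossLMS1991.prop37_2_frobeniusCongruence` (the one print fact
  the tree already uses for McCallum's Prop. 4.4 «in particular», `JET.prop44_of_frobeniusCongruence`) through
  `prop37_2_reductionCongruence_of_frobeniusCongruence`: on any frame the named McCallum facts {`h44`, `hMcU`}
  thereby rest on ONE published congruence plus the Cassels–Tate inputs and `hF1`.

References: [McCallumLMS1991] §1 Theorem, §4 (5)–(6), Cor. 4.5, §5 Lemma 5.1, Thm. 5.4, Cor. 5.5, Cor. 5.6;
[Jetchev2008] p. 812 (1), Cor. 1.5; [GrossLMS1991] §3 Prop. 3.7 (2), §4 (4.1), Props. 5.3, 5.4, §6 Prop. 6.2 (1);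
[GrossZagier1986] III (3.1); [MilneADT2006] I §6 Prop. 6.9, Thm. 6.13(a); [Kolyvagin1991MathAnn] §1.
-/

noncomputable section

open scoped Classical Pointwise

namespace Summit.BirchSwinnertonDyer.Rank1Residual.X11b.KolyvaginOrder
open WeierstrassCurve NumberField IsDedekindDomain Field Function
open Literature.NumberTheory.EllipticCurves Literature.NumberTheory.EllipticCurves.KolyvaginDescent
open Literature.NumberTheory.EllipticCurves.KolyvaginCocycle
open Literature.NumberTheory.EllipticCurves.RingClassField
open Literature.NumberTheory.EllipticCurves.ModularForms
open Literature.NumberTheory.GaloisRepresentations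
open Literature.NumberTheory.GaloisCohomology
open Literature.NumberTheory.GaloisRepresentations.DiscreteGaloisModule (mu MuCarrier)
open Literature.NumberTheory.EllipticCurves.GrossLMS1991 (prop37_2_reductionCongruence)
open Summit.BirchSwinnertonDyer.Rank1Residual.X11b.KolyvaginAssembly
open Summit.BirchSwinnertonDyer.Rank1Residual.X11b.KolyvaginCT

-- Cup products need `LocallyCompactSpace Γ_K`; as in the tree's Cassels–Tate files.
attribute [local instance] absoluteGaloisGroup_compactSpace

-- `CharZero` of the completions (the Cassels–Tate local terms), as in the tree's files.
attribute [local instance] charZero_placeCompletion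

variable (W : WeierstrassCurve ℚ) {K : Type} [Field K] [NumberField K] {N : ℕ}

/-- **The refined Kolyvagin bound at one odd surjective prime on a GIVEN frame, from {Gross §6 /
[GZ86 III (3.1)] (`hE0`), Gross Prop. 3.7 (2) (`hγ`)} + the class-form global divisibility `hDivT` on
the frame + the displayed Cassels–Tate inputs:** `Ш(E/K)[p^∞]` finite, killed by `p^{M₀}`,
`#Ш(E/K)[p^∞] ≤ p^{2(M₀−t)}`, `ord_p #Ш(E/K)[p^∞] + 2t ≤ 2M₀` (McCallum 1991 Cor. 5.6 as the upper bound
with `m ≥ t`; Jetchev 2008 (1)). CONDITIONAL; nothing booked.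
[cite: McCallumLMS1991, §1 Theorem (Kolyvagin), Lemma 5.1, Thm. 5.4, Cor. 5.6]
[cite: Jetchev2008, p. 812 (1) and Cor. 1.5] [cite: GrossLMS1991, §3 Prop. 3.7 (2), §6 Prop. 6.2 (1)]
[cite: GrossZagier1986, III (3.1)] [cite: MilneADT2006, Ch. I §6, Prop. 6.9, Thm. 6.13(a)] -/
theorem card_sha_primary_le_at_of_divT_frame_of_gross1991E0_of_prop37_of_localDuality [NeZero N]
    [W.IsGloballyMinimal] [W.IsElliptic] (hN : N = W.conductorNorm ℤ) (hE : ¬ W.HasCM)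
    (hK : IsImaginaryQuadratic K) (hD34 : NumberField.discr K ≠ -3 ∧ NumberField.discr K ≠ -4)
    (hH : SatisfiesHeegnerHypothesis N K) {P : (W.baseChange K).toAffine.Point}
    (hHP : IsHeegnerPoint N W K P) (hnt : ¬ IsOfFinAddOrder P) {p : ℕ} (hp : p.Prime) (hp2 : p ≠ 2)
    (hρ : W.HasSurjectiveModNGaloisRep p)
    (hE0 : Gross1991_heegnerPoint_sub_ratTorsion_mem_E0) (hγ : prop37_2_reductionCongruence N W K p)
    (Dt : ModularParametrizationData W N) (β : ℤ) (ι : K →+* ℂ)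
    (hβ : (4 * N : ℤ) ∣ β ^ 2 - NumberField.discr K)
    (hc1 : ∀ d : KolyvaginHeegnerData Dt β ι 1,
      d.toGeomPoints d.derivedPoint = toGeomPoints (W.baseChange K) P)
    (t : ℕ)
    (hDivT : ∀ {M : ℕ} (_hM : 1 ≤ M) {n : ℕ} (_hn : Squarefree n)
      (_hKol : ∀ q ∈ n.primeFactors, IsKolyvaginPrime N W K p q ∧ FrobEqFrobInfty W K (p ^ M) q)
      (d : (m : ℕ) → m ∣ n → KolyvaginHeegnerData Dt β ι m),
      ((p : ℤ) ^ (M - t)) • (d n dvd_rfl).kolyvaginClass hp M = 0)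
    {M₀ : ℕ} (hM₀ : 1 ≤ M₀) [NeZero (p ^ M₀)] {c : K ≃ₐ[ℚ] K} (hc : c ≠ 1) (hcc : c * c = 1)
    {x₀ : (W.baseChange K).toAffine.Point} (hx₀ : p ^ M₀ • x₀ = P)
    (hmax : ∀ Q : (W.baseChange K).toAffine.Point, p ^ (M₀ + 1) • Q ≠ P)
    (e : geomTorsion (W.baseChange K) ((p ^ M₀ * p ^ M₀ : ℕ) : ℤ) →
      geomTorsion (W.baseChange K) ((p ^ M₀ * p ^ M₀ : ℕ) : ℤ) → AlgebraicClosure K)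
    (hμ : ∀ S T, e S T ^ (p ^ M₀ * p ^ M₀) = 1)
    (hadd₁ : ∀ S₁ S₂ T, e (S₁ + S₂) T = e S₁ T * e S₂ T)
    (hadd₂ : ∀ S T₁ T₂, e S (T₁ + T₂) = e S T₁ * e S T₂)
    (hgal : ∀ (σ : absoluteGaloisGroup K) (S T : geomTorsion (W.baseChange K) ((p ^ M₀ * p ^ M₀ : ℕ) : ℤ)),
      σ • e S T = e (σ • S) (σ • T))
    (halt : ∀ T, e T T = 1) (hnondeg : ∀ T, (∀ S, e S T = 1) → T = 0)
    (inv : LocalInvariants K (p ^ M₀ * p ^ M₀)) (hPT' : inv.SumInvLocalizationEqZero)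
    (hinv : ∀ v : HeightOneSpectrum (𝓞 K), Injective (inv (Sum.inr v)))
    (hH3 : ∀ x : galoisCohomology (mu K (p ^ M₀ * p ^ M₀)) 3,
      (∀ v : Place K, galoisCohomology.localization (mu K (p ^ M₀ * p ^ M₀)) v 3 x = 0) → x = 0)
    (hB : Literature.GroupTheory.FiniteAbelian.IsLevelPairing (p ^ M₀)
      (ctLevelPairing (W.baseChange K) (p ^ M₀) e hμ hadd₁ hadd₂ hgal inv halt hPT' hH3
        (localTerm_finite_support (W := W.baseChange K) (m := p ^ M₀) (e := e) (hμ := hμ)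
          (hadd₁ := hadd₁) (hadd₂ := hadd₂) (hgal := hgal) halt inv)))
    (hPτ : ∀ z ∈ selmerGroup (W.baseChange K) ((p ^ M₀ * p ^ M₀ : ℕ) : ℤ),
      ∀ t ∈ selmerGroup (W.baseChange K) ((p ^ M₀ * p ^ M₀ : ℕ) : ℤ),
      ctGeneralFun (W.baseChange K) (p ^ M₀) e hμ hadd₁ hadd₂ hgal inv
          (torsionH1ToH1 (W.baseChange K) _ (conjAct W c _ z))
          (torsionH1ToH1 (W.baseChange K) _ (conjAct W c _ t)) =
        ctGeneralFun (W.baseChange K) (p ^ M₀) e hμ hadd₁ hadd₂ hgal inv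
          (torsionH1ToH1 (W.baseChange K) _ z) (torsionH1ToH1 (W.baseChange K) _ t)) :
    Finite (AddCommGroup.primaryComponent (W.baseChange K).sha p) ∧
    (∀ c ∈ AddCommGroup.primaryComponent (W.baseChange K).sha p, p ^ M₀ • c = 0) ∧
    Nat.card (AddCommGroup.primaryComponent (W.baseChange K).sha p) ≤ p ^ (2 * (M₀ - t)) ∧
    padicValNat p (Nat.card (AddCommGroup.primaryComponent (W.baseChange K).sha p)) + 2 * t ≤
      2 * M₀ :=
  card_sha_primary_le_at_of_pointsMDiv_of_reciprocityFinset_of_localDuality W hK hHP hnt hp hp2 hρ hM₀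
    hc hcc hx₀ hmax t
    (hpoints_at_of_perLevelChoice_of_divT_frame hN hK hD34 hH hHP hp hp2 hρ Dt β ι hβ hc1
      (KolyvaginLeaves.hCM_holds N W K p) (KolyvaginLeaves.h53_holds hN p)
      (@fun _ hK' hH' Dt' _ ι' _ _ _ hn hKol d ↦
        KolyvaginHloc.hGZ_of_gross1991E0 hE0 hN hE hK' hD34 hH' ι' Dt' hp hp2 hρ hn hKol d)
      (hγ.endBinder (@fun _ ↦ hE) hD34 hp hp2 (@fun _ ↦ hρ) (@fun _ ↦ hN)) t hDivT)
    (@fun _ hM _ hℓ hℓM ↦ KolyvaginReciprocity.kolyvaginReciprocityFinset_of_poitouTate N W K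
      (poitouTate_sum_localTatePairing_eq_zero_holds K) hE hK hD34 hH hHP hnt hp hp2 hρ hM hℓ hℓM)
    e hμ hadd₁ hadd₂ hgal halt hnondeg inv hPT' hinv hH3 hB hPτ

end Summit.BirchSwinnertonDyer.Rank1Residual.X11b.KolyvaginOrder

/-! ## The named fact `McCallum1991_padicValNat_card_sha_primary_add_le_of_globalDivisibility` DERIVED -/

namespace Literature.NumberTheory.EllipticCurves

open WeierstrassCurve NumberField IsDedekindDomain Field Function
open Literature.NumberTheory.EllipticCurves.KolyvaginCocycle
open Literature.NumberTheory.EllipticCurves.RingClassField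
open Literature.NumberTheory.EllipticCurves.ModularForms
open Literature.NumberTheory.GaloisRepresentations
open Literature.NumberTheory.GaloisCohomology
open Summit.BirchSwinnertonDyer.Rank1Residual.X11b

-- Cup products need `LocallyCompactSpace Γ_K`; as in the tree's Cassels–Tate files.
attribute [local instance] absoluteGaloisGroup_compactSpace

-- `CharZero` of the completions (the Cassels–Tate local terms), as in the tree's files.
attribute [local instance] charZero_placeCompletion

/-- **McCallum 1991 Cor. 5.6, upper half under global divisibility (the named fact
`McCallum1991_padicValNat_card_sha_primary_add_le_of_globalDivisibility`), DERIVED from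
{`casselsTate_levelInputs` (every number field), Gross 1991 Prop. 3.7 (2)
(`GrossLMS1991.prop37_2_reductionCongruence`, every frame), Gross 1991 §6 / [GZ86 III (3.1)]
(`Gross1991_heegnerPoint_sub_ratTorsion_mem_E0`)}** — the «Tamagawa-absorbing» Kolyvagin–McCallum bound
`ord_p #Ш(E/K)[p^∞] + 2t ≤ 2 ord_p [E(K) : ℤ y_K]` whenever every derived Heegner point `P_n`
(`n ∈ S(M)`, `M ≥ s`) is `p^s`-divisible for all `s ≤ t`, BY KERNEL over x11b3-p2's Kolyvagin-descent
chain and this seat's divisible refinement (module docstring for the dictionary). CONDITIONAL on the three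
facts; nothing booked; no mark moves. [cite: McCallumLMS1991, §1 Theorem, §4 Cor. 4.5, §5 Lemma 5.1, Thm. 5.4, Cor. 5.6 (p. 310)]
[cite: Jetchev2008, p. 812 (1) and Cor. 1.5] [cite: GrossLMS1991, §3 Prop. 3.7 (2), §4 (4.1), §6 Prop. 6.2 (1)]
[cite: GrossZagier1986, III (3.1)] [cite: MilneADT2006, Ch. I §6, Prop. 6.9, Thm. 6.13(a)] -/
theorem McCallum1991_padicValNat_card_sha_primary_add_le_of_globalDivisibility_of_casselsTate_of_prop37_of_E0
    (hCTf : ∀ (K : Type) [Field K] [NumberField K], casselsTate_levelInputs K)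
    (hγf : ∀ (N : ℕ) [NeZero N] (W : WeierstrassCurve ℚ) [W.IsGloballyMinimal]
      (K : Type) [Field K] [NumberField K] (p : ℕ), GrossLMS1991.prop37_2_reductionCongruence N W K p)
    (hE0 : Gross1991_heegnerPoint_sub_ratTorsion_mem_E0) :
    McCallum1991_padicValNat_card_sha_primary_add_le_of_globalDivisibility := by
  intro W _ _ _ hE K _ _ hK hD3 hD4 hH p _ hp2 htower Dt β ι d₁ P hP1 hnt M₀ hM₀div hM₀max t hglob
  have hp : p.Prime := Fact.out
  have hρ : W.HasSurjectiveModNGaloisRep p := by simpa using htower 1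
  have hD34 : NumberField.discr K ≠ -3 ∧ NumberField.discr K ≠ -4 := ⟨hD3, hD4⟩
  have hrec := heegnerPointOfConductor_one_galoisConj_holds (W.conductorNorm ℤ) W K
  -- `P ↔ P(1)` on the fact's frame
  have hmapP : WeierstrassCurve.Affine.Point.map (W' := W)
      (algebraMap K (ringClassField K ι 1)).toRatAlgHom P = d₁.derivedPoint := by
    apply WeierstrassCurve.Affine.Point.map_injective (W' := W) d₁.emb.toRatAlgHom
    change d₁.toGeomPoints _ = d₁.toGeomPoints _
    rw [KolyvaginBottom.toGeomPoints_map_algebraMap d₁ P, hP1]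
  -- the Heegner display of `P` on THIS frame (Shimura reciprocity at conductor `1`)
  obtain ⟨H, hHβ⟩ := exists_heegnerDatum (W.conductorNorm ℤ) hK.discr_neg d₁.dvd_sq_sub
  have hPH : WeierstrassCurve.Affine.Point.map (W' := W) ι.toRatAlgHom P = heegnerPointComplex Dt H := by
    obtain ⟨e1, he1⟩ := hrec hK hH Dt β ι d₁ H hHβ
    have hι : ι.toRatAlgHom = (ringClassField K ι 1).subtype.toRatAlgHom.comp
        (algebraMap K (ringClassField K ι 1)).toRatAlgHom := by
      ext x
      rfl
    rw [hι, ← WeierstrassCurve.Affine.Point.map_map, hmapP, d₁.derivedPoint_one, map_sum,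
      heegnerPointComplex, ← Finset.sum_coe_sort H.reps, ← Finset.sum_coe_sort d₁.S]
    exact Fintype.sum_equiv e1 _ _ fun s ↦ he1 s
  have hHP : IsHeegnerPoint (W.conductorNorm ℤ) W K P := ⟨Dt, H, ι, hPH⟩
  have hc1 : ∀ d : KolyvaginHeegnerData Dt β ι 1,
      d.toGeomPoints d.derivedPoint = (W.baseChange K).toGeomPoints P :=
    fun d ↦ KolyvaginBottom.toGeomPoints_derivedPoint_one_eq hrec hK hH hPH d hHβ
  -- the class-form divisibility on the frame, from the fact's global divisibility at depth `min M t`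
  have hDivT : ∀ {M : ℕ} (_hM : 1 ≤ M) {n : ℕ} (_hn : Squarefree n)
      (_hKol : ∀ q ∈ n.primeFactors, IsKolyvaginPrime (W.conductorNorm ℤ) W K p q ∧
        FrobEqFrobInfty W K (p ^ M) q)
      (d : (m : ℕ) → m ∣ n → KolyvaginHeegnerData Dt β ι m),
      ((p : ℤ) ^ (M - t)) • (d n dvd_rfl).kolyvaginClass hp M = 0 := by
    intro M hM n hn hKol d
    have hZ : ∀ ℓ ∈ n.primeFactors, Zhang2014.IsKolyvaginPrime (W.conductorNorm ℤ) W K p ℓ ∧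
        min M t ≤ Zhang2014.kolyvaginIndex W p ℓ := by
      intro ℓ hℓ
      obtain ⟨⟨hℓP, hℓN, hℓD, hℓp, hprime, -⟩, hfrob⟩ := hKol ℓ hℓ
      have hidx : M ≤ Zhang2014.kolyvaginIndex W p ℓ :=
        McCallum1991.le_kolyvaginIndex_of_frobEqFrobInfty W K hp hM hℓP hℓp hℓN hfrob
      exact ⟨⟨hℓP, hℓN, hℓD, hℓp, hprime, lt_of_lt_of_le (by omega) hidx⟩, (min_le_left _ _).trans hidx⟩
    obtain ⟨Q, hQ⟩ := hglob (min M t) (min_le_right M t) n (d n dvd_rfl) hn hZ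
    set dn := d n dvd_rfl with hdn
    by_cases hadm : KolyvaginCocycle.IsAdmissible (Field.absoluteGaloisGroup K) dn.pointsSubgroup
          ((p ^ M : ℕ) : ℤ) ∧
        dn.toGeomPoints dn.derivedPoint ∈
          KolyvaginCocycle.invPoints (Field.absoluteGaloisGroup K) dn.pointsSubgroup ((p ^ M : ℕ) : ℤ)
    swap
    · rw [KolyvaginHeegnerData.kolyvaginClass, dif_neg hadm, zsmul_zero]
    obtain ⟨hA, hP⟩ := hadm
    rw [KolyvaginHeegnerData.kolyvaginClass_of_admissible _ hp M hA hP]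
    obtain ⟨Q0, hQ0⟩ := (W.baseChange K).zsmul_geomPoints_surjective_of_charZero
      (n := ((p ^ M : ℕ) : ℤ)) (by exact_mod_cast pow_ne_zero M hp.ne_zero) (dn.toGeomPoints dn.derivedPoint)
    simp only at hQ0
    have hkP : ((p : ℤ) ^ (M - t)) • dn.toGeomPoints dn.derivedPoint ∈
        KolyvaginCocycle.invPoints (Field.absoluteGaloisGroup K) dn.pointsSubgroup ((p ^ M : ℕ) : ℤ) :=
      AddSubgroup.zsmul_mem _ hP _
    have hkQ : ((p ^ M : ℕ) : ℤ) • (((p : ℤ) ^ (M - t)) • Q0) =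
        ((p : ℤ) ^ (M - t)) • dn.toGeomPoints dn.derivedPoint := by
      rw [smul_comm, hQ0]
    rw [kolyvaginClass_eq_cls hA hP hQ0, ← cls_zsmul hA _ hP hQ0 ((p : ℤ) ^ (M - t)) hkP hkQ]
    refine cls_eq_zero_of_mem hA _ hkP hkQ ⟨dn.toGeomPoints Q, ⟨Q, rfl⟩, ?_⟩
    have hexp : M - t + min M t = M := by omega
    have hsc : ((p : ℤ) ^ (M - t)) * ((p ^ min M t : ℕ) : ℤ) = ((p ^ M : ℕ) : ℤ) := by
      push_cast
      rw [← pow_add, hexp]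
    rw [← hQ, ← map_zsmul, ← map_zsmul, smul_smul, hsc]
  -- the generator `x₀` and the maximality, in the END's currency
  obtain ⟨x₀, hx₀'⟩ := hM₀div
  have hx₀ : p ^ M₀ • x₀ = P := by rw [← natCast_zsmul]; exact_mod_cast hx₀'
  have hmax : ∀ Q : (W.baseChange K).toAffine.Point, p ^ (M₀ + 1) • Q ≠ P := fun Q hQ ↦
    hM₀max ⟨Q, by rw [← natCast_zsmul] at hQ; exact_mod_cast hQ⟩
  rcases Nat.eq_zero_or_pos M₀ with h0 | hpos
  · -- `M₀ = 0`: `Ш(E/K)[p^∞] = 0` (x11b3's annihilator END at `m = 0`) and `t = 0` (McCallum Lemma 5.1)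
    subst h0
    have ht0 : t = 0 := by
      by_contra ht
      obtain ⟨Q₁, hQ₁⟩ := hglob t le_rfl 1 d₁ squarefree_one (by simp)
      have hP' : Three.Koly.PDiv d₁ p t := ⟨Q₁, hQ₁⟩
      obtain ⟨Q, hQ⟩ := (Three.Koly.pDiv_one_iff_exists_zsmul_eq hK d₁ P hmapP p t
        (fun R hR ↦ RingClassNoTorsion.eq_zero_of_zsmul_pow_eq_zero_ringClassField W hK ι one_ne_zero
          hp hp2 hρ t R hR)).mp hP'
      refine hM₀max ⟨((p ^ (t - 1) : ℕ) : ℤ) • Q, ?_⟩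
      rw [smul_smul, ← Nat.cast_mul, ← pow_add, show 0 + 1 + (t - 1) = t by omega, hQ]
    subst ht0
    have hkill := KolyvaginDischarged.pow_smul_sha_primary_eq_zero_at_of_gross1991E0_of_prop37
      (N := W.conductorNorm ℤ) (W := W) (K := K) hp hp2 (@fun _ ↦ rfl) hE0
      (hγf (W.conductorNorm ℤ) W K p) hE hK hD34 hH hHP hnt hρ (m := 0) hmax
    have hbot : ∀ c ∈ AddCommGroup.primaryComponent (W.baseChange K).sha p, c = 0 := by
      intro c hc
      obtain ⟨j, hj⟩ := (AddCommGroup.mem_primaryComponent).1 hc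
      simpa using hkill c ⟨j, hj⟩
    have hcard : Nat.card (AddCommGroup.primaryComponent (W.baseChange K).sha p) = 1 := by
      rw [Nat.card_eq_one_iff_exists]
      exact ⟨⟨0, zero_mem _⟩, fun c ↦ Subtype.ext (hbot c.1 c.2)⟩
    rw [hcard]
    simp
  -- `M₀ ≥ 1`: the END on the fact's frame, with the Weil pairing at level `p^{2M₀}` and the
  -- Cassels–Tate inputs from `casselsTate_levelInputs`
  haveI : NeZero (p ^ M₀) := ⟨pow_ne_zero _ hp.ne_zero⟩
  obtain ⟨c, hc1', hcc⟩ := exists_conj_of_isImaginaryQuadratic (K := K) hK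
  have h2 : 2 ≤ p ^ M₀ * p ^ M₀ :=
    le_trans (le_trans hp.two_le (Nat.le_self_pow hpos.ne' p)) (Nat.le_mul_of_pos_right _ (NeZero.pos (p ^ M₀)))
  have hq : ((p ^ M₀ * p ^ M₀ : ℕ) : K) ≠ 0 := Nat.cast_ne_zero.mpr (NeZero.ne (p ^ M₀ * p ^ M₀))
  obtain ⟨e, hμ, hadd₁, hadd₂, halt, hnd, hgal⟩ :=
    (W.baseChange K).exists_weilPairing_holds (p ^ M₀ * p ^ M₀) h2 hq
  obtain ⟨inv, hPT', hH3, hperf, hB, hPτ⟩ := hCTf K W p M₀ hp hp2 hpos c hc1' hcc e hμ hadd₁ hadd₂ hgal halt hnd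
  exact (KolyvaginOrder.card_sha_primary_le_at_of_divT_frame_of_gross1991E0_of_prop37_of_localDuality W rfl hE
    hK hD34 hH hHP hnt hp hp2 hρ hE0 (hγf (W.conductorNorm ℤ) W K p) Dt β ι d₁.dvd_sq_sub hc1 t hDivT hpos
    hc1' hcc hx₀ hmax e hμ hadd₁ hadd₂ hgal halt hnd inv hPT' (fun v ↦ (hperf v).1.injective) hH3 hB
    hPτ).2.2.2

/-- **The same bound keyed to the IMAGE-FREE congruence** (the ONE print fact the tree already uses for
McCallum's Prop. 4.4 «in particular», `JET.prop44_of_frobeniusCongruence`): since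
`GrossLMS1991.prop37_2_frobeniusCongruence` (Gross 1991 Prop. 3.7 (2) in Nekovář's image-free rendering)
implies `prop37_2_reductionCongruence N W K p` at every frame
(`prop37_2_reductionCongruence_of_frobeniusCongruence`), McCallum's Cor. 5.6 upper half under global
divisibility follows from the Cassels–Tate level inputs, that congruence, and Gross's `E⁰` fact alone —
so on any frame the pair {`h44`, `hMcU`} of named McCallum facts rests on ONE published congruence plus
the Cassels–Tate inputs. [cite: McCallumLMS1991, §5 Cor. 5.6 (p. 311), Thm. 5.8 (p. 312)]
[cite: GrossLMS1991, Prop. 3.7 (2) (p. 240)] [cite: Nekovar2007, Prop. 4.13 (ii)] -/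
theorem McCallum1991_padicValNat_card_sha_primary_add_le_of_globalDivisibility_of_casselsTate_of_frobeniusCongruence_of_E0
    (hCTf : ∀ (K : Type) [Field K] [NumberField K], casselsTate_levelInputs K)
    (h372 : GrossLMS1991.prop37_2_frobeniusCongruence)
    (hE0 : Gross1991_heegnerPoint_sub_ratTorsion_mem_E0) :
    McCallum1991_padicValNat_card_sha_primary_add_le_of_globalDivisibility :=
  McCallum1991_padicValNat_card_sha_primary_add_le_of_globalDivisibility_of_casselsTate_of_prop37_of_E0
    hCTf (fun N _ W _ K _ _ p ↦ GrossLMS1991.prop37_2_reductionCongruence_of_frobeniusCongruence h372 N W K p)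
    hE0

end Literature.NumberTheory.EllipticCurves

end
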